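import Summits.BirchSwinnertonDyer.Rank1Residual.X2.CongruenceTransferForms
import Summits.BirchSwinnertonDyer.Rank1Residual.X2.CongruentLambdaShiftMultiplicative
import HarnessLib

/-!
# Class X2: ROUTE G at `p ‖ N` WITHOUT the typed input — the transferred invariants, Mazur's main
# conjecture and `BSD(E₀, p)` for pairs with a MULTIPLICATIVE member, the shift
# `e = Σ_{v∈Σ₀}(δ' − δ) + e_p(E₀') − e_p(E₀)` DERIVED (Greenberg–Vatsal 2000 Thm. (1.4) at `p ‖ N`)
# (cell `b2b-bsdres`, unit `b2b-bsdres-eisenstein-p2`, gen 14)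

HONEST FRAMING (run/shared/lean/b2b/bsd-rank1-residual/, verbatim in every file): the goal of the
cell is to DELETE the COMBINATION-SHAPED residual classes of the Birch–Swinnerton-Dyer formula for
ALL analytic-rank `≤ 1` elliptic curves over `ℚ` — "full BSD formula for every rank `≤ 1` curve in
class `C`" assembled STRICTLY from published theorems — so that the rank-`≤ 1` remainder becomes
exactly the CONSTRUCTION-SHAPED classes, which are TYPED (missing-input `Prop`s), NOT attempted.
This is not "finishing BSD". Research route; NO CLAIM BEYOND STATED CLASSES; nothing here changes a
label; X2b and X2c stay CONSTRUCTION-SHAPED (route G is a per-pair CERTIFICATE route). Theorems only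
(no definition, no named fact, nothing asserted).

Gen 11 (`X2/CongruenceTransferDerived.lean`) replaced the typed per-pair input
`CongruentLambdaShift W W' p e` of gen 7's route-G theorems by a kernel theorem for two GOOD-ORDINARY
members; gen 13 (`X2/CongruentLambdaShiftMultiplicative.lean`) derived it for pairs with a
MULTIPLICATIVE member (`congruentLambdaShift_{mult_goodOrd, goodOrd_mult, mult_mult}_of_facts`, the
trivial-zero shift `e_p = 1` split / `0` non-split EXPLICIT). This file is the mechanical sequel (gen
13's successor item (i)): the `_of_facts` forms of gen 7's theorems of `X2/CongruenceTransferForms.lean`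
for
* an X2 TARGET with a closed X2 RELATIVE (mult–mult): `algebraicInvariantsEq_of_closedRelative_mult_of_facts`,
  `mazurMainConjectureAt_of_closedRelative_mult_of_facts`, `bsdp_of_closedRelative_mult_rankZero_of_facts`
  — `k = k' + Σ(δ' − δ) + e_p(E₀') − e_p(E₀)`;
* an X2 TARGET with a closed X1-leaf RELATIVE (mult–good): `…_goodOrd_of_facts` —
  `k = n' + Σ(δ' − δ) − e_p(E₀)`;
* an X1-leaf TARGET with a closed X2 RELATIVE (good–mult): `Leaf.bsdp_of_closedRelative_mult_of_facts`
  — `k = k' + Σ(δ' − δ) + e_p(E₀')`.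
"Closed relative" = Mazur's main conjecture known at the relative's pair (per pair, by certificate:
lamMin / P / T / an X1-leaf route; or — `X2/CongruenceTransferCovered.lean` — PUBLISHED, for a good
non-anomalous relative). The shift is now supplied by PRINTED statements: Tate's uniformisation
A40/A41 (`hT`, `hT'`), GV (5)–(7) at `p ‖ N` (`hAm`), GV Prop. 2.5/p. 25 in datum form (`hBm`),
GV p. 15 (`hF`, split `p` only), and for a good-ordinary member GV p. 26 (`hGV`), GV (7) (`hA7`),
GV p. 8 (`hB`); plus `Σ₀ ∌ p`, a finite set of places outside which both curves have good reduction,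
and the local multiplicities `δ` (`GreenbergVatsal2000.delta`; per pair by `X2/LocalDeltaCalculus`).

References: [GreenbergVatsal2000] Thm. (1.4), §1 (5)–(7) pp. 7–8, pp. 14–15, §2 Prop. (2.1),
(2.4), (2.5), (2.8), pp. 20–27; [Wuthrich2014] Thm. 16; [SteinWuthrich2013] Thm. 6.1;
[GreenbergLNM1716] Thm. 4.1; HOME/b2b-bsdres-eisenstein-p2/X2-GAP.md §18–§19.
-/

set_option autoImplicit false

noncomputable section

open scoped Classical MatrixGroups ModularForm

open PowerSeries CongruenceSubgroup WeierstrassCurve NumberField IsDedekindDomain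
  Literature.NumberTheory.EllipticCurves
  Literature.NumberTheory.EllipticCurves.ModularForms
  Literature.NumberTheory.EllipticCurves.Rank1Residual
  Literature.NumberTheory.EllipticCurves.Rank1Residual.Typed
  Literature.NumberTheory.EllipticCurves.Wuthrich2014
  Literature.NumberTheory.EllipticCurves.SteinWuthrich2013
  Literature.NumberTheory.EllipticCurves.Greenberg1999
  Literature.NumberTheory.EllipticCurves.GreenbergVatsal2000
  Summit.BirchSwinnertonDyer.BirchSwinnertonDyer.Theorems.Rank1ResidualX1Defs
  Summit.BirchSwinnertonDyer.Rank1Residual.X1.MuLambda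
  Summit.BirchSwinnertonDyer.Rank1Residual.X1.MuPart
  Summit.BirchSwinnertonDyer.Rank1Residual.X1.ParitySqueeze
  Summit.BirchSwinnertonDyer.Rank1Residual.X1.TamagawaSqueeze
  Summit.BirchSwinnertonDyer.Rank1Residual.X1.CongruenceTransfer
  Summit.BirchSwinnertonDyer.Rank1Residual.X2.CongruentLambdaShiftMultiplicative

namespace Summit.BirchSwinnertonDyer.Rank1Residual.X2

/-! ## §1. X2 TARGET, closed X2 RELATIVE (mult–mult) -/

section MultMult

variable {W W' : WeierstrassCurve ℚ} [W.IsElliptic] [W.IsGloballyMinimal]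
  [W'.IsElliptic] [W'.IsGloballyMinimal] {p : ℕ} [Fact p.Prime]
  (S₀ : Finset (HeightOneSpectrum (𝓞 ℚ)))

/-- **X2 target, ANY multiplicative relative with exact invariants, shift DERIVED.** Target
`(E₀, p)`: `p ≠ 2` multiplicative, `E₀[p]` reducible, `μ_an(E₀) = 0`. Relative `E₀'`: multiplicative
at `p` with `AlgebraicInvariantsEq W' p k'`. `E₀[p] ≅ E₀'[p]`, `Σ₀ ∌ p` ⊇ bad places of both off
`p`, and **`k = k' + Σ_{v∈Σ₀}(δ' − δ) + e_p(E₀') − e_p(E₀)`**. Gen 7's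
`algebraicInvariantsEq_of_congruentLambdaShift` + gen 13's `congruentLambdaShift_mult_mult_of_facts`.
[cite: GreenbergVatsal2000, Thm. (1.4), §1 (5)–(7), pp. 14–15, §2 pp. 20–27]
[cite: Wuthrich2014, Thm. 16 (p. 397)] -/
theorem algebraicInvariantsEq_of_torsionIso_mult_mult_of_facts
    (hWu : thm16_charIdeal_dvd_multiplicative_of_reducible)
    (hpar : nonempty_modularParametrizationData)
    (hT : Silverman1994_thmV53_corV54_tateUniformisation.{0})
    (hT' : Silverman1994_thmV53_tateUniformisation.{0})
    (hAm : lambda_nonPrimitive_eq_add_sum_delta_multiplicative)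
    (hBm : datumSelmer_divisible_of_finite_torsionBy) (hF : datumStrictSelmer_lt_datumSelmer_of_split)
    (hp2 : p ≠ 2) (hmult : W.HasMultiplicativeReductionAtPrime p)
    (hred : ¬ W.HasIrreducibleModPGaloisRep p) (hμ0 : AnalyticMuLE W p 0)
    (hmult' : W'.HasMultiplicativeReductionAtPrime p)
    (hS₀ : ∀ v ∈ S₀, ((p : ℕ) : 𝓞 ℚ) ∉ v.asIdeal)
    (hS : ∀ v : HeightOneSpectrum (𝓞 ℚ), v ∉ S₀ → ((p : ℕ) : 𝓞 ℚ) ∉ v.asIdeal →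
      W.HasGoodReductionAt v)
    (hS' : ∀ v : HeightOneSpectrum (𝓞 ℚ), v ∉ S₀ → ((p : ℕ) : 𝓞 ℚ) ∉ v.asIdeal →
      W'.HasGoodReductionAt v)
    {k' : ℕ} (hinv' : AlgebraicInvariantsEq W' p k') (hiso : TorsionIso W W' p) {k : ℕ}
    (hk : (k : ℤ) = k' +
      (∑ v ∈ S₀, ((delta W' p v : ℤ) - (delta W p v : ℤ))
        + (if W'.HasSplitMultiplicativeReductionAtPrime p then 1 else 0)
        - (if W.HasSplitMultiplicativeReductionAtPrime p then 1 else 0))) :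
    AlgebraicInvariantsEq W p k :=
  algebraicInvariantsEq_of_congruentLambdaShift hWu hpar hp2 hmult hred hμ0 hinv' hiso
    (CongruentLambdaShiftMultiplicative.congruentLambdaShift_mult_mult_of_facts W W' S₀ hT hT' hAm hBm
      hF hp2 hmult hmult' hS₀ hS hS') hk

/-- **X2 target, CLOSED X2 relative, shift DERIVED**: the relative `(E₀', p)` multiplicative with
Mazur's main conjecture at the pair (`X2.MazurMainConjectureAt W' p`), `μ_an = 0`, `λ_an = n'`, so
invariants `(0, k')` with `k' + e_p(E₀') = n'`; **`k = k' + Σ(δ' − δ) + e_p(E₀') − e_p(E₀)`**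
(`= n' + Σ(δ' − δ) − e_p(E₀)`). [cite: GreenbergVatsal2000, Thm. (1.4), §1 (5)–(7), pp. 14–15, §2 pp. 20–27]
[cite: Wuthrich2014, Thm. 16 (p. 397)] -/
theorem algebraicInvariantsEq_of_closedRelative_mult_of_facts
    (hWu : thm16_charIdeal_dvd_multiplicative_of_reducible)
    (hpar : nonempty_modularParametrizationData)
    (hT : Silverman1994_thmV53_corV54_tateUniformisation.{0})
    (hT' : Silverman1994_thmV53_tateUniformisation.{0})
    (hAm : lambda_nonPrimitive_eq_add_sum_delta_multiplicative)
    (hBm : datumSelmer_divisible_of_finite_torsionBy) (hF : datumStrictSelmer_lt_datumSelmer_of_split)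
    (hp2 : p ≠ 2) (hmult : W.HasMultiplicativeReductionAtPrime p)
    (hred : ¬ W.HasIrreducibleModPGaloisRep p) (hμ0 : AnalyticMuLE W p 0)
    (hmult' : W'.HasMultiplicativeReductionAtPrime p) (hMC' : X2.MazurMainConjectureAt W' p)
    {n' k' : ℕ} (hμ0' : AnalyticMuLE W' p 0) (hlam' : AnalyticLambdaEq W' p n')
    (hk'N : ¬ W'.HasSplitMultiplicativeReductionAtPrime p → k' = n')
    (hk'S : W'.HasSplitMultiplicativeReductionAtPrime p → k' + 1 = n')
    (hS₀ : ∀ v ∈ S₀, ((p : ℕ) : 𝓞 ℚ) ∉ v.asIdeal)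
    (hS : ∀ v : HeightOneSpectrum (𝓞 ℚ), v ∉ S₀ → ((p : ℕ) : 𝓞 ℚ) ∉ v.asIdeal →
      W.HasGoodReductionAt v)
    (hS' : ∀ v : HeightOneSpectrum (𝓞 ℚ), v ∉ S₀ → ((p : ℕ) : 𝓞 ℚ) ∉ v.asIdeal →
      W'.HasGoodReductionAt v)
    (hiso : TorsionIso W W' p) {k : ℕ}
    (hk : (k : ℤ) = k' +
      (∑ v ∈ S₀, ((delta W' p v : ℤ) - (delta W p v : ℤ))
        + (if W'.HasSplitMultiplicativeReductionAtPrime p then 1 else 0)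
        - (if W.HasSplitMultiplicativeReductionAtPrime p then 1 else 0))) :
    AlgebraicInvariantsEq W p k :=
  algebraicInvariantsEq_of_torsionIso_mult_mult_of_facts S₀ hWu hpar hT hT' hAm hBm hF hp2 hmult hred hμ0
    hmult' hS₀ hS hS'
    (algebraicInvariantsEq_of_mazurMainConjectureAt hpar W' p hmult' hMC' hμ0' hlam' hk'N hk'S) hiso hk

/-- **Mazur's main conjecture at the X2 pair from a CLOSED X2 relative, shift DERIVED** (both
ranks): with the target's certificates `μ_an(E₀) = 0`, `λ_an(E₀) = n` and `n ≤ k` (non-split) /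
`n ≤ k + 1` (split). At an X2b pair this is its typed input, at an X2c pair the cyclotomic main
conjecture. [cite: GreenbergVatsal2000, Thm. (1.4), §1 (5)–(7), pp. 14–15, §2 pp. 20–27]
[cite: Wuthrich2014, Thm. 16 (p. 397)] -/
theorem mazurMainConjectureAt_of_closedRelative_mult_of_facts
    (hWu : thm16_charIdeal_dvd_multiplicative_of_reducible)
    (hpar : nonempty_modularParametrizationData)
    (hT : Silverman1994_thmV53_corV54_tateUniformisation.{0})
    (hT' : Silverman1994_thmV53_tateUniformisation.{0})
    (hAm : lambda_nonPrimitive_eq_add_sum_delta_multiplicative)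
    (hBm : datumSelmer_divisible_of_finite_torsionBy) (hF : datumStrictSelmer_lt_datumSelmer_of_split)
    (hp2 : p ≠ 2) (hmult : W.HasMultiplicativeReductionAtPrime p)
    (hred : ¬ W.HasIrreducibleModPGaloisRep p) {n : ℕ} (hμ0 : AnalyticMuLE W p 0)
    (hlam : AnalyticLambdaEq W p n)
    (hmult' : W'.HasMultiplicativeReductionAtPrime p) (hMC' : X2.MazurMainConjectureAt W' p)
    {n' k' : ℕ} (hμ0' : AnalyticMuLE W' p 0) (hlam' : AnalyticLambdaEq W' p n')
    (hk'N : ¬ W'.HasSplitMultiplicativeReductionAtPrime p → k' = n')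
    (hk'S : W'.HasSplitMultiplicativeReductionAtPrime p → k' + 1 = n')
    (hS₀ : ∀ v ∈ S₀, ((p : ℕ) : 𝓞 ℚ) ∉ v.asIdeal)
    (hS : ∀ v : HeightOneSpectrum (𝓞 ℚ), v ∉ S₀ → ((p : ℕ) : 𝓞 ℚ) ∉ v.asIdeal →
      W.HasGoodReductionAt v)
    (hS' : ∀ v : HeightOneSpectrum (𝓞 ℚ), v ∉ S₀ → ((p : ℕ) : 𝓞 ℚ) ∉ v.asIdeal →
      W'.HasGoodReductionAt v)
    (hiso : TorsionIso W W' p) {k : ℕ}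
    (hk : (k : ℤ) = k' +
      (∑ v ∈ S₀, ((delta W' p v : ℤ) - (delta W p v : ℤ))
        + (if W'.HasSplitMultiplicativeReductionAtPrime p then 1 else 0)
        - (if W.HasSplitMultiplicativeReductionAtPrime p then 1 else 0)))
    (hkN : ¬ W.HasSplitMultiplicativeReductionAtPrime p → n ≤ k)
    (hkS : W.HasSplitMultiplicativeReductionAtPrime p → n ≤ k + 1) : X2.MazurMainConjectureAt W p :=
  mazurMainConjectureAt_of_algebraicInvariantsEq hWu W p hp2 hmult hred hμ0 hlam
    (algebraicInvariantsEq_of_closedRelative_mult_of_facts S₀ hWu hpar hT hT' hAm hBm hF hp2 hmult hred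
      hμ0 hmult' hMC' hμ0' hlam' hk'N hk'S hS₀ hS hS' hiso hk) hkN hkS

/-- **HEADLINE (rank `0`, CLOSED X2 relative, shift DERIVED): `BSD(E₀, p)`** — gen 7's
`bsdp_of_closedRelative_mult_rankZero` without the typed `CongruentLambdaShift`.
[cite: GreenbergVatsal2000, Thm. (1.4), §1 (5)–(7), pp. 14–15, §2 pp. 20–27]
[cite: Wuthrich2014, Thm. 16 (p. 397)] [cite: SteinWuthrich2013, Thm. 6.1 (p. 20)] -/
theorem bsdp_of_closedRelative_mult_rankZero_of_facts
    (hWu : thm16_charIdeal_dvd_multiplicative_of_reducible)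
    (hJs : thm61_splitMultiplicative) (hJn : thm61_nonsplitMultiplicative)
    (hHs : exists_isSplitMultCanonical) (hHn : exists_isMultCanonical)
    (hGZK : rank_eq_analyticRank_of_analyticRank_le_one) (hmod : hasEntireLFunction_rat)
    (hpar : nonempty_modularParametrizationData)
    (hT : Silverman1994_thmV53_corV54_tateUniformisation.{0})
    (hT' : Silverman1994_thmV53_tateUniformisation.{0})
    (hAm : lambda_nonPrimitive_eq_add_sum_delta_multiplicative)
    (hBm : datumSelmer_divisible_of_finite_torsionBy) (hF : datumStrictSelmer_lt_datumSelmer_of_split)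
    (W W' : WeierstrassCurve ℚ) [W.IsElliptic] [W.IsGloballyMinimal] [W'.IsElliptic]
    [W'.IsGloballyMinimal] (p : ℕ) [Fact p.Prime] (hGS : greenberg_stevens (W := W) (p := p))
    (hp2 : p ≠ 2) (hmult : W.HasMultiplicativeReductionAtPrime p)
    (hred : ¬ W.HasIrreducibleModPGaloisRep p) (hr : W.analyticRank = 0) {n : ℕ}
    (hμ0 : AnalyticMuLE W p 0) (hlam : AnalyticLambdaEq W p n)
    (hmult' : W'.HasMultiplicativeReductionAtPrime p) (hMC' : X2.MazurMainConjectureAt W' p)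
    {n' k' : ℕ} (hμ0' : AnalyticMuLE W' p 0) (hlam' : AnalyticLambdaEq W' p n')
    (hk'N : ¬ W'.HasSplitMultiplicativeReductionAtPrime p → k' = n')
    (hk'S : W'.HasSplitMultiplicativeReductionAtPrime p → k' + 1 = n')
    (hS₀ : ∀ v ∈ S₀, ((p : ℕ) : 𝓞 ℚ) ∉ v.asIdeal)
    (hS : ∀ v : HeightOneSpectrum (𝓞 ℚ), v ∉ S₀ → ((p : ℕ) : 𝓞 ℚ) ∉ v.asIdeal →
      W.HasGoodReductionAt v)
    (hS' : ∀ v : HeightOneSpectrum (𝓞 ℚ), v ∉ S₀ → ((p : ℕ) : 𝓞 ℚ) ∉ v.asIdeal →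
      W'.HasGoodReductionAt v)
    (hiso : TorsionIso W W' p) {k : ℕ}
    (hk : (k : ℤ) = k' +
      (∑ v ∈ S₀, ((delta W' p v : ℤ) - (delta W p v : ℤ))
        + (if W'.HasSplitMultiplicativeReductionAtPrime p then 1 else 0)
        - (if W.HasSplitMultiplicativeReductionAtPrime p then 1 else 0)))
    (hkN : ¬ W.HasSplitMultiplicativeReductionAtPrime p → n ≤ k)
    (hkS : W.HasSplitMultiplicativeReductionAtPrime p → n ≤ k + 1) : BSDp W p :=
  bsdp_of_algebraicInvariantsEq_rankZero hWu hJs hJn hHs hHn hGZK hmod hpar W p hGS hp2 hmult hred hr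
    hμ0 hlam (algebraicInvariantsEq_of_closedRelative_mult_of_facts S₀ hWu hpar hT hT' hAm hBm hF hp2
      hmult hred hμ0 hmult' hMC' hμ0' hlam' hk'N hk'S hS₀ hS hS' hiso hk) hkN hkS

end MultMult

/-! ## §2. X2 TARGET, closed X1-leaf RELATIVE (mult–good ordinary) -/

section MultGood

variable {W W' : WeierstrassCurve ℚ} [W.IsElliptic] [W.IsGloballyMinimal]
  [W'.IsElliptic] [W'.IsGloballyMinimal] {p : ℕ} [Fact p.Prime]
  (S₀ : Finset (HeightOneSpectrum (𝓞 ℚ)))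

/-- **X2 target, CLOSED good-ordinary relative, shift DERIVED**: relative `(E₀', p)` good ordinary
Eisenstein with `MazurMainConjecture W' p`, `μ_an = 0`, `λ_an = n'` (invariants `(0, n')`);
**`k = n' + Σ(δ' − δ) − e_p(E₀)`**. Gen 7's `algebraicInvariantsEq_of_closedRelative_goodOrd` + gen
13's `congruentLambdaShift_mult_goodOrd_of_facts`.
[cite: GreenbergVatsal2000, Thm. (1.4), §1 (5)–(7), pp. 14–15, §2 pp. 20–27]
[cite: Wuthrich2014, Thm. 16 (p. 397)] -/
theorem algebraicInvariantsEq_of_closedRelative_goodOrd_of_facts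
    (hWu : thm16_charIdeal_dvd_multiplicative_of_reducible)
    (hW16 : Wuthrich2014.charIdeal_dvd_padicLFunction)
    (hpar : nonempty_modularParametrizationData)
    (hT : Silverman1994_thmV53_corV54_tateUniformisation.{0})
    (hT' : Silverman1994_thmV53_tateUniformisation.{0})
    (hAm : lambda_nonPrimitive_eq_add_sum_delta_multiplicative)
    (hBm : datumSelmer_divisible_of_finite_torsionBy) (hF : datumStrictSelmer_lt_datumSelmer_of_split)
    (hGV : imKummer_ge_greenbergCondition_at_p) (hA7 : lambda_nonPrimitive_eq_add_sum_delta)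
    (hB : divisible_nonPrimitiveSelmerInfty_of_mu_eq_zero) (hp2 : p ≠ 2)
    (hmult : W.HasMultiplicativeReductionAtPrime p) (hred : ¬ W.HasIrreducibleModPGaloisRep p)
    (hμ0 : AnalyticMuLE W p 0)
    (hgood' : W'.HasGoodReductionAtPrime p) (hord' : ¬ (p : ℤ) ∣ W'.frobeniusTrace p)
    (hred' : ¬ W'.HasIrreducibleModPGaloisRep p) (hMC' : MazurMainConjecture W' p) {n' : ℕ}
    (hμ0' : X1.MuPart.AnalyticMuLE W' p 0) (hlam' : X1.ParitySqueeze.AnalyticLambdaEq W' p n')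
    (hS₀ : ∀ v ∈ S₀, ((p : ℕ) : 𝓞 ℚ) ∉ v.asIdeal)
    (hS : ∀ v : HeightOneSpectrum (𝓞 ℚ), v ∉ S₀ → ((p : ℕ) : 𝓞 ℚ) ∉ v.asIdeal →
      W.HasGoodReductionAt v)
    (hS' : ∀ v : HeightOneSpectrum (𝓞 ℚ), v ∉ S₀ → ((p : ℕ) : 𝓞 ℚ) ∉ v.asIdeal →
      W'.HasGoodReductionAt v)
    (hiso : TorsionIso W W' p) {k : ℕ}
    (hk : (k : ℤ) = n' +
      (∑ v ∈ S₀, ((delta W' p v : ℤ) - (delta W p v : ℤ))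
        - (if W.HasSplitMultiplicativeReductionAtPrime p then 1 else 0))) :
    AlgebraicInvariantsEq W p k :=
  algebraicInvariantsEq_of_closedRelative_goodOrd hWu hW16 hpar hp2 hmult hred hμ0 hgood' hord' hred'
    hMC' hμ0' hlam' hiso
    (CongruentLambdaShiftMultiplicative.congruentLambdaShift_mult_goodOrd_of_facts W W' S₀ hT hT' hAm
      hBm hF hGV hA7 hB hp2 hmult hgood' hord' hS₀ hS hS') hk

/-- **HEADLINE (rank `0`, CLOSED X1-leaf relative, shift DERIVED): `BSD(E₀, p)`** — gen 7's
`bsdp_of_closedRelative_goodOrd_rankZero` without the typed `CongruentLambdaShift`; `n ≤ k`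
(non-split) / `n ≤ k + 1` (split). [cite: GreenbergVatsal2000, Thm. (1.4), §1 (5)–(7), pp. 14–15, §2 pp. 20–27]
[cite: Wuthrich2014, Thm. 16 (p. 397)] [cite: SteinWuthrich2013, Thm. 6.1 (p. 20)] -/
theorem bsdp_of_closedRelative_goodOrd_rankZero_of_facts
    (hWu : thm16_charIdeal_dvd_multiplicative_of_reducible)
    (hW16 : Wuthrich2014.charIdeal_dvd_padicLFunction)
    (hJs : thm61_splitMultiplicative) (hJn : thm61_nonsplitMultiplicative)
    (hHs : exists_isSplitMultCanonical) (hHn : exists_isMultCanonical)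
    (hGZK : rank_eq_analyticRank_of_analyticRank_le_one) (hmod : hasEntireLFunction_rat)
    (hpar : nonempty_modularParametrizationData)
    (hT : Silverman1994_thmV53_corV54_tateUniformisation.{0})
    (hT' : Silverman1994_thmV53_tateUniformisation.{0})
    (hAm : lambda_nonPrimitive_eq_add_sum_delta_multiplicative)
    (hBm : datumSelmer_divisible_of_finite_torsionBy) (hF : datumStrictSelmer_lt_datumSelmer_of_split)
    (hGV : imKummer_ge_greenbergCondition_at_p) (hA7 : lambda_nonPrimitive_eq_add_sum_delta)
    (hB : divisible_nonPrimitiveSelmerInfty_of_mu_eq_zero)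
    (W W' : WeierstrassCurve ℚ) [W.IsElliptic] [W.IsGloballyMinimal] [W'.IsElliptic]
    [W'.IsGloballyMinimal] (p : ℕ) [Fact p.Prime] (hGS : greenberg_stevens (W := W) (p := p))
    (hp2 : p ≠ 2) (hmult : W.HasMultiplicativeReductionAtPrime p)
    (hred : ¬ W.HasIrreducibleModPGaloisRep p) (hr : W.analyticRank = 0) {n : ℕ}
    (hμ0 : AnalyticMuLE W p 0) (hlam : AnalyticLambdaEq W p n)
    (hgood' : W'.HasGoodReductionAtPrime p) (hord' : ¬ (p : ℤ) ∣ W'.frobeniusTrace p)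
    (hred' : ¬ W'.HasIrreducibleModPGaloisRep p) (hMC' : MazurMainConjecture W' p) {n' : ℕ}
    (hμ0' : X1.MuPart.AnalyticMuLE W' p 0) (hlam' : X1.ParitySqueeze.AnalyticLambdaEq W' p n')
    (hS₀ : ∀ v ∈ S₀, ((p : ℕ) : 𝓞 ℚ) ∉ v.asIdeal)
    (hS : ∀ v : HeightOneSpectrum (𝓞 ℚ), v ∉ S₀ → ((p : ℕ) : 𝓞 ℚ) ∉ v.asIdeal →
      W.HasGoodReductionAt v)
    (hS' : ∀ v : HeightOneSpectrum (𝓞 ℚ), v ∉ S₀ → ((p : ℕ) : 𝓞 ℚ) ∉ v.asIdeal →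
      W'.HasGoodReductionAt v)
    (hiso : TorsionIso W W' p) {k : ℕ}
    (hk : (k : ℤ) = n' +
      (∑ v ∈ S₀, ((delta W' p v : ℤ) - (delta W p v : ℤ))
        - (if W.HasSplitMultiplicativeReductionAtPrime p then 1 else 0)))
    (hkN : ¬ W.HasSplitMultiplicativeReductionAtPrime p → n ≤ k)
    (hkS : W.HasSplitMultiplicativeReductionAtPrime p → n ≤ k + 1) : BSDp W p :=
  bsdp_of_algebraicInvariantsEq_rankZero hWu hJs hJn hHs hHn hGZK hmod hpar W p hGS hp2 hmult hred hr
    hμ0 hlam (algebraicInvariantsEq_of_closedRelative_goodOrd_of_facts S₀ hWu hW16 hpar hT hT' hAm hBm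
      hF hGV hA7 hB hp2 hmult hred hμ0 hgood' hord' hred' hMC' hμ0' hlam' hS₀ hS hS' hiso hk) hkN hkS

end MultGood

/-! ## §3. X1-leaf TARGET, closed X2 RELATIVE (good ordinary–mult) -/

section GoodMult

variable {W W' : WeierstrassCurve ℚ} [W.IsElliptic] [W.IsGloballyMinimal]
  [W'.IsElliptic] [W'.IsGloballyMinimal] {p : ℕ} [Fact p.Prime]
  (S₀ : Finset (HeightOneSpectrum (𝓞 ℚ)))

/-- **On the X1 leaf with a CLOSED X2 relative: `BSD(E₀, p)`, shift DERIVED.** Target `(E₀, p)`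
on the leaf (`ClassX1 ∧ r_an = 0`) with `μ_an = 0`, `λ_an = n`; relative `(E₀', p)` multiplicative
with Mazur's MC at the pair, `μ_an = 0`, `λ_an = n'`, `k' + e_p(E₀') = n'`; `E₀[p] ≅ E₀'[p]`;
`Σ₀ ∌ p` ⊇ bad places of both off `p`; **`k = k' + Σ(δ' − δ) + e_p(E₀')`** (`= n' + Σ(δ' − δ)`)
and `n ≤ k`. Gen 7's `Leaf.bsdp_of_closedRelative_mult` + gen 13's
`congruentLambdaShift_goodOrd_mult_of_facts` (census `p = 3`: the `44a` family ← `66a1@3`).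
[cite: GreenbergVatsal2000, Thm. (1.4), §1 (5)–(7), pp. 14–15, §2 pp. 20–27]
[cite: GreenbergLNM1716, Thm. 4.1] [cite: Wuthrich2014, Thm. 16 (p. 397)] -/
theorem Leaf.bsdp_of_closedRelative_mult_of_facts
    (hW16 : Wuthrich2014.charIdeal_dvd_padicLFunction) (hGr : greenberg_charValue_rankZero)
    (hmod : nonempty_modularParametrizationData)
    (hGZK : rank_eq_analyticRank_of_analyticRank_le_one)
    (hT : Silverman1994_thmV53_corV54_tateUniformisation.{0})
    (hT' : Silverman1994_thmV53_tateUniformisation.{0})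
    (hAm : lambda_nonPrimitive_eq_add_sum_delta_multiplicative)
    (hBm : datumSelmer_divisible_of_finite_torsionBy) (hF : datumStrictSelmer_lt_datumSelmer_of_split)
    (hGV : imKummer_ge_greenbergCondition_at_p) (hA7 : lambda_nonPrimitive_eq_add_sum_delta)
    (hB : divisible_nonPrimitiveSelmerInfty_of_mu_eq_zero) (hL : X1.RankZero.Leaf W p) {n : ℕ}
    (hμ0 : X1.MuPart.AnalyticMuLE W p 0) (hlam : X1.ParitySqueeze.AnalyticLambdaEq W p n)
    (hmult' : W'.HasMultiplicativeReductionAtPrime p) (hMC' : X2.MazurMainConjectureAt W' p)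
    {n' k' : ℕ} (hμ0' : AnalyticMuLE W' p 0) (hlam' : AnalyticLambdaEq W' p n')
    (hk'N : ¬ W'.HasSplitMultiplicativeReductionAtPrime p → k' = n')
    (hk'S : W'.HasSplitMultiplicativeReductionAtPrime p → k' + 1 = n')
    (hS₀ : ∀ v ∈ S₀, ((p : ℕ) : 𝓞 ℚ) ∉ v.asIdeal)
    (hS : ∀ v : HeightOneSpectrum (𝓞 ℚ), v ∉ S₀ → ((p : ℕ) : 𝓞 ℚ) ∉ v.asIdeal →
      W.HasGoodReductionAt v)
    (hS' : ∀ v : HeightOneSpectrum (𝓞 ℚ), v ∉ S₀ → ((p : ℕ) : 𝓞 ℚ) ∉ v.asIdeal →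
      W'.HasGoodReductionAt v)
    (hiso : TorsionIso W W' p) {k : ℕ}
    (hk : (k : ℤ) = k' +
      (∑ v ∈ S₀, ((delta W' p v : ℤ) - (delta W p v : ℤ))
        + (if W'.HasSplitMultiplicativeReductionAtPrime p then 1 else 0)))
    (hn : n ≤ k) : BSDp W p :=
  have hX := isClassX1_of_classX1 hL.classX1
  Leaf.bsdp_of_algebraicInvariantsEq hW16 hGr hmod hGZK hL hμ0
    (algebraicInvariantsEq_of_congruentLambdaShift_goodOrd hW16 hmod hX.two_ne
      hX.hasGoodReductionAtPrime hX.not_dvd_frobeniusTrace hX.not_hasIrreducibleModPGaloisRep hμ0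
      (algebraicInvariantsEq_of_mazurMainConjectureAt hmod W' p hmult' hMC' hμ0' hlam' hk'N hk'S)
      hiso
      (CongruentLambdaShiftMultiplicative.congruentLambdaShift_goodOrd_mult_of_facts W' W S₀ hT hT'
        hAm hBm hF hGV hA7 hB hX.two_ne hmult' hX.hasGoodReductionAtPrime hX.not_dvd_frobeniusTrace
        hS₀ hS' hS)
      hk) hlam hn

end GoodMult

end Summit.BirchSwinnertonDyer.Rank1Residual.X2

end
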